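import Summits.ResolutionOfSingularities.ResolutionOfSingularities.Theorems.EquisingularLiftEquisingularLiftNatNoseTowerDefs
import HarnessLib

/-!
# Route `EquisingularLift`, crux EL♮ (stmt-ResolutionOfSingularities-20038) / EL♮(3) (stmt-…-20148) — rungs TOWER and NOSE-TOWER, RATIONAL-CARRIER
# re-cut (director-resolution RULING W4.5b NOSETOWER / GROTHENDIECK EXISTENCE, 2026-08-27T16:09:04Z; res-L1-w45b-plan-1 g13 RULING-4, CHAIN v7.24):
# `RationalCarrier`, `TowerRound₀`, `ReachTower₀`, `ReachNoseTower₀` — append-only successors of …NatTowerDefs (p541504) / …NatNoseTowerDefs (p544518)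

res-L1-w45b-lead-2 g2 (lead). OURS; planning vocabulary of the crux chain, not a statement of any manuscript; AI-written, weaker than expert
review. WHY: the upstairs supplier of a Čech-witnessed round (`DirStepUnobs`) lifts a (multi)section of the exceptional ruled surface over the
O-smooth carrier curve; over a carrier of POSITIVE genus this needs Grothendieck existence (EGA III₁ 5.1.4 — in the tree only as a Hodge-summit
named fact, hypothesis-only), so an UNCONDITIONAL W4.5b stub must restrict Čech-witnessed rounds to carriers of arithmetic genus 0 (res-type-027's
T-P1VB, parts 1–13, is exactly the `ℙ¹` supplier); cone-witnessed rounds (`ConeWitness`) stay genus-free (no H¹). «POSGENUS-ROUND» is booked as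
research debt inside the residues (admission path = FACT-LIST §F row F-88 `GrothendieckExistence`, then a conditional closer).
* `RationalCarrier C` — «the reduced carrier curve is a projective line»: `C ≅ ℙ¹_{k'}` for some field `k'` (downstairs certificate; the supplier
  identifies `k'` with the route's `k` through its model square). Scheme-level, so that it fits K5′'s `Reach` slot (no field in scope).
* `TowerRound₀` — `TowerRound` (p541504) with `RationalCarrier (redSub F₉ Z₉ hZ₉)` added to the Čech disjunct; the cone disjunct unchanged.
* `ReachTower₀` — `ReachTower` with `TowerRound₀` (the registered TOWER rung is re-cut to this predicate; INST = one application of K5′).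
* `ReachNoseTower₀ k n H ι` — `ReachNoseTower` with the nose itself a projective line over the route's `k` (`Nonempty (Z̃ ≅ ℙ¹_k)`) and `TowerRound₀`.
Every specimen of record has a rational carrier / nose (S-F′ v2: cone rounds; arm P: rational carrier; quartic / monomial-curve noses): kill line unchanged.
-/

set_option linter.dupNamespace false

noncomputable section

open CategoryTheory AlgebraicGeometry TopologicalSpace
open Literature.AlgebraicGeometry.Resolution (IsBlowup)

namespace Summit.ResolutionOfSingularities.ResolutionOfSingularities.Cruxes.EquisingularLiftNat.Sections

/-- **Rational carrier** (downstairs certificate): the scheme `C` (a reduced carrier curve) is isomorphic to the projective line over SOME field.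
[OURS · planning vocabulary] -/
def RationalCarrier (C : Scheme.{0}) : Prop :=
  ∃ (k' : Type) (_ : Field k'), Nonempty (C ≅ (Literature.AlgebraicGeometry.Motives.projectiveSpace 1 k').left)

/-- **TOWER / (round-full), rational-carrier re-cut** — `TowerRound` (…NatTowerDefs) with the Čech-witnessed disjunct restricted to a RATIONAL
carrier curve `Z̃₉ ≅ ℙ¹` (T-P1VB's regime); the cone-witnessed disjunct is unchanged (genus-free). Downstairs only. -/
def TowerRound₀ (F₉ F₁₀ : Scheme.{0}) (υ' : F₁₀ ⟶ F₉) (Z₉ : Set F₉) (hZ₉ : IsClosed Z₉)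
    (R₁ : ∀ G : Scheme.{0}, (G ⟶ F₁₀) → Set G → Set G → Set G → Prop) : Prop :=
  ∀ (G G' : Scheme.{0}) (γ : G ⟶ F₁₀) (T E K : Set G) (hE : IsClosed E) (Z : Set G) (hZ : IsClosed Z) (υ₂ : G' ⟶ G),
    R₁ G γ T E K →
    Z ⊆ E ∩ T → Z.Nonempty →
    TowerFull F₉ F₁₀ υ' Z₉ hZ₉ G γ Z hZ →
    ((RationalCarrier (redSub F₉ Z₉ hZ₉) ∧
        (∀ x : redSub G Z hZ, IsRegularLocalRing (G.presheaf.stalk (redSubι G Z hZ x))) ∧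
        (∀ (i : redSub G Z hZ ⟶ redSub G E hE), i ≫ redSubι G E hE = redSubι G Z hZ →
          ∀ x : redSub G Z hZ, IsRegularLocalRing ((redSub G E hE).presheaf.stalk (i x))) ∧
        DirStepUnobs G E hE Z hZ) ∨
      ConeWitness G E hE K Z hZ) →
    IsBlowup υ₂ (Scheme.IdealSheafData.vanishingIdeal (⟨Z, hZ⟩ : Closeds G)) →
    R₁ G' (υ₂ ≫ γ) (closure (υ₂ ⁻¹' (T \ Z))) (υ₂ ⁻¹' Z) (closure (υ₂ ⁻¹' (K \ Z))) ∧
      R₁ G' (υ₂ ≫ γ) (closure (υ₂ ⁻¹' (T \ Z))) (closure (υ₂ ⁻¹' (E \ Z))) (closure (υ₂ ⁻¹' (K \ Z)))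

/-- **ReachTower₀** — `ReachTower` (…NatTowerDefs) with `TowerRound₀` in place of `TowerRound` (Čech rounds over rational carriers only).
Downstairs only; K5′'s `Reach` slot. -/
def ReachTower₀ (F₁ F₂ : Scheme.{0}) (υ : F₂ ⟶ F₁) (x : F₁) (T₂ : Set F₂) (F' : Scheme.{0}) (β : F' ⟶ F₂) (T' : Set F') : Prop :=
  ∃ (W : Set F₁) (F₉ : Scheme.{0}) (β₉ : F₉ ⟶ F₂) (T₉ Z₉ K₉ : Set F₉) (b₉ : Bool) (hZ₉ : IsClosed Z₉)
    (F₁₀ : Scheme.{0}) (υ' : F₁₀ ⟶ F₉) (γ' : F' ⟶ F₁₀) (E' K' : Set F'),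
    x ∈ W ∧ ¬ (υ ⁻¹' {x} ⊆ closure (υ ⁻¹' (W \ {x}))) ∧
    (∃ U : F₁.affineOpens, x ∈ (U : F₁.Opens) ∧
      ((Scheme.IdealSheafData.vanishingIdeal (⟨closure W, isClosed_closure⟩ : Closeds F₁)).ideal U).IsPrincipal) ∧
    υ ⁻¹' {x} ∩ closure (υ ⁻¹' (W \ {x})) ⊆ T₂ ∧
    InCarrierReachK F₂ T₂ (υ ⁻¹' {x} ∩ closure (υ ⁻¹' (W \ {x}))) (closure (υ ⁻¹' (W \ {x}))) F₉ β₉ T₉ Z₉ K₉ b₉ ∧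
    Z₉ ⊆ T₉ ∧ ¬ (T₉ ⊆ Z₉) ∧
    Set.Finite {z : redSub F₉ Z₉ hZ₉ | ¬ IsRegularLocalRing ((redSub F₉ Z₉ hZ₉).presheaf.stalk z)} ∧
    IsBlowup υ' (Scheme.IdealSheafData.vanishingIdeal (⟨Z₉, hZ₉⟩ : Closeds F₉)) ∧
    (∀ R₁ : (∀ G : Scheme.{0}, (G ⟶ F₁₀) → Set G → Set G → Set G → Prop),
      R₁ F₁₀ (𝟙 F₁₀) (closure (υ' ⁻¹' (T₉ \ Z₉))) (υ' ⁻¹' Z₉) (closure (υ' ⁻¹' (K₉ \ Z₉))) →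
      TowerPtReg F₁₀ R₁ → TowerPtRam F₁₀ R₁ → TowerRound₀ F₉ F₁₀ υ' Z₉ hZ₉ R₁ → R₁ F' γ' T' E' K') ∧
    β = (γ' ≫ υ') ≫ β₉

/-- **NOSE-TOWER, rational-nose re-cut** — `ReachNoseTower` (…NatNoseTowerDefs) with the class-₂ nose a PROJECTIVE LINE over the route's `k`
(`Nonempty (Z̃ ≅ ℙ¹_k)`: smooth rational noses of every degree — every specimen of record) and `TowerRound₀`. Downstairs only. -/
def ReachNoseTower₀ (k : Type) [Field k] (n : ℕ) (H : Scheme.{0})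
    (ι : H ⟶ (Literature.AlgebraicGeometry.Motives.projectiveSpace n k).left) : Prop :=
  ∃ (Z : Set (Literature.AlgebraicGeometry.Motives.projectiveSpace n k).left) (hZ : IsClosed Z),
    IsLiftableNoseClass₂ k n Z ∧ Z ⊆ Set.range ι ∧ ¬ (Set.range ι ⊆ Z) ∧
    Nonempty (redSub (Literature.AlgebraicGeometry.Motives.projectiveSpace n k).left Z hZ ≅
      (Literature.AlgebraicGeometry.Motives.projectiveSpace 1 k).left) ∧
    ∃ (F₂ : Scheme.{0}) (υ : F₂ ⟶ (Literature.AlgebraicGeometry.Motives.projectiveSpace n k).left),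
      IsBlowup υ (Scheme.IdealSheafData.vanishingIdeal
        (⟨Z, hZ⟩ : Closeds (Literature.AlgebraicGeometry.Motives.projectiveSpace n k).left)) ∧
      ∃ (F' : Scheme.{0}) (γ' : F' ⟶ F₂) (T' E' K' : Set F'),
        (∀ R₁ : (∀ G : Scheme.{0}, (G ⟶ F₂) → Set G → Set G → Set G → Prop),
          R₁ F₂ (𝟙 F₂) (closure (υ ⁻¹' (Set.range ι \ Z))) (υ ⁻¹' Z) ∅ →
          TowerPtReg F₂ R₁ → TowerPtRam F₂ R₁ →
          TowerRound₀ (Literature.AlgebraicGeometry.Motives.projectiveSpace n k).left F₂ υ Z hZ R₁ →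
          R₁ F' γ' T' E' K') ∧
        Literature.AlgebraicGeometry.Resolution.Scheme.IsRegular (redSub F' (closure T') isClosed_closure)

/-- Sanity: a rational-carrier tower round is a tower round (the re-cut only NARROWS the Čech disjunct). [OURS · pure logic] -/
theorem towerRound_of_towerRound₀ (F₉ F₁₀ : Scheme.{0}) (υ' : F₁₀ ⟶ F₉) (Z₉ : Set F₉) (hZ₉ : IsClosed Z₉)
    (R₁ : ∀ G : Scheme.{0}, (G ⟶ F₁₀) → Set G → Set G → Set G → Prop) (h : TowerRound F₉ F₁₀ υ' Z₉ hZ₉ R₁) :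
    TowerRound₀ F₉ F₁₀ υ' Z₉ hZ₉ R₁ := by
  intro G G' γ T E K hE Z hZ υ₂ hR hZET hne hfull hadm hυ₂
  refine h G G' γ T E K hE Z hZ υ₂ hR hZET hne hfull ?_ hυ₂
  rcases hadm with ⟨-, hG, hEreg, hunobs⟩ | hcone
  · exact Or.inl ⟨hG, hEreg, hunobs⟩
  · exact Or.inr hcone

/-- Sanity: every `ReachTower₀` chain is a `ReachTower` chain. [OURS · pure logic] -/
theorem reachTower_of_reachTower₀ (F₁ F₂ : Scheme.{0}) (υ : F₂ ⟶ F₁) (x : F₁) (T₂ : Set F₂) (F' : Scheme.{0}) (β : F' ⟶ F₂)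
    (T' : Set F') (h : ReachTower₀ F₁ F₂ υ x T₂ F' β T') : ReachTower F₁ F₂ υ x T₂ F' β T' := by
  obtain ⟨W, F₉, β₉, T₉, Z₉, K₉, b₉, hZ₉, F₁₀, υ', γ', E', K', h1, h2, h3, h4, h5, h6, h7, h8, h9, hcl, hβ⟩ := h
  exact ⟨W, F₉, β₉, T₉, Z₉, K₉, b₉, hZ₉, F₁₀, υ', γ', E', K', h1, h2, h3, h4, h5, h6, h7, h8, h9,
    fun R₁ hseed hreg hram hround => hcl R₁ hseed hreg hram (towerRound_of_towerRound₀ F₉ F₁₀ υ' Z₉ hZ₉ R₁ hround), hβ⟩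

end Summit.ResolutionOfSingularities.ResolutionOfSingularities.Cruxes.EquisingularLiftNat.Sections

end
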